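import Summits.KontsevichZagierPeriods.KontsevichZagierPeriods.Theorems.LinRedNormalFormArrangementNormalFormSeparateTwoNormEquiv
import Summits.KontsevichZagierPeriods.KontsevichZagierPeriods.Theorems.LinRedNormalFormArrangementNormalFormSeparateTwoMonoSplit

/-!
# The monomial split, unconditional form

(Line `janus-bands`, crux `ArrangementNormalForm`, stub `stub_separateTwoPos`, part
`MonoSplitGlue`.) Parts `NormEquiv` (`SepTwo.coeff_le_box`) and `MonoSplit` (`SepTwo.monoSplit`)
combined: under an almost-decreasing measurable weight `W` on `(0, 4δ) × (0, 4ε)` (constant `K`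
at scale `4`; for the fibre mass in blown-up coordinates at a point this is `separateTwo_corner`),
every monomial of a polynomial that is absolutely integrable against `W` is absolutely integrable
on `(0, δ) × (0, ε)` — `SepTwo.monoSplit'`, registered as `separateTwo_monoSplitGlue`. This is
the termwise-convergence input of the numerator split `GG♮ → GG` (`separatePos_split`,
hypothesis `hI`) at a point of the closed base piece where the numerator vanishes, for the
pieces whose pole is the edge direction (Taylor pieces = monomial rows); non-edge poles add
`separateTwo_angular` + `separateTwo_cornerLog`, far poles `separateTwo_radialLog`.
-/

noncomputable section

open Set MeasureTheory
open scoped ENNReal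

namespace Summit.KontsevichZagierPeriods.ArrangementNormalForm.JanusBands

namespace SepTwo

/-- **The monomial split under an almost-decreasing weight (unconditional).** -/
theorem monoSplit' (d : ℕ) (c : Fin (d + 1) → Fin (d + 1) → ℝ) (W : ℝ → ℝ → ℝ≥0∞)
    (hW : Measurable (Function.uncurry W)) (K : ℝ≥0∞) (hK : K ≠ ∞) (δ ε : ℝ)
    (hmono : ∀ x v x' v', 0 < x → x ≤ x' → x' ≤ 4 * x → x' < 4 * δ → 0 < v → v ≤ v' →
      v' ≤ 4 * v → v' < 4 * ε → W x v ≤ K * W x' v')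
    (hfin : ∫⁻ x in Ioo 0 (4 * δ), ∫⁻ v in Ioo 0 (4 * ε),
      ENNReal.ofReal |∑ i', ∑ j', c i' j' * x ^ (i' : ℕ) * v ^ (j' : ℕ)| * W x v < ∞)
    (i j : Fin (d + 1)) :
    ∫⁻ x in Ioo 0 δ, ∫⁻ v in Ioo 0 ε,
      ENNReal.ofReal (|c i j| * x ^ (i : ℕ) * v ^ (j : ℕ)) * W x v < ∞ := by
  obtain ⟨C, -, hC⟩ := coeff_le_box d
  exact monoSplit d C hC c W hW K hK δ ε hmono hfin i j

end SepTwo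

/-- **The monomial split under an almost-decreasing weight, unconditional form** (registered
part of `stub_separateTwoPos`; `separateTwo_monoSplit` with its norm-equivalence hypothesis
discharged by `separateTwo_normEquiv`). -/
theorem separateTwo_monoSplitGlue (d : ℕ) (c : Fin (d + 1) → Fin (d + 1) → ℝ) (W : ℝ → ℝ → ENNReal) (hW : Measurable (Function.uncurry W)) (K : ENNReal) (hK : K ≠ ⊤) (δ ε : ℝ) (hmono : ∀ x v x' v' : ℝ, 0 < x → x ≤ x' → x' ≤ 4 * x → x' < 4 * δ → 0 < v → v ≤ v' → v' ≤ 4 * v → v' < 4 * ε → W x v ≤ K * W x' v') (hfin : MeasureTheory.lintegral (MeasureTheory.volume.restrict (Set.Ioo 0 (4 * δ))) (fun x => MeasureTheory.lintegral (MeasureTheory.volume.restrict (Set.Ioo 0 (4 * ε))) (fun v => ENNReal.ofReal |∑ i' : Fin (d + 1), ∑ j' : Fin (d + 1), c i' j' * x ^ (i' : ℕ) * v ^ (j' : ℕ)| * W x v)) < ⊤) (i j : Fin (d + 1)) : MeasureTheory.lintegral (MeasureTheory.volume.restrict (Set.Ioo 0 δ)) (fun x => MeasureTheory.lintegral (MeasureTheory.volume.restrict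 (Set.Ioo 0 ε)) (fun v => ENNReal.ofReal (|c i j| * x ^ (i : ℕ) * v ^ (j : ℕ)) * W x v)) < ⊤ := by
  exact SepTwo.monoSplit' d c W hW K hK δ ε hmono hfin i j

end Summit.KontsevichZagierPeriods.ArrangementNormalForm.JanusBands
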